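import Literature.NumberTheory.GaloisRepresentations.ArtinRestriction
import HarnessLib

/-!
# `\bar ℤ_K ≅ \bar ℤ_M` along the restriction `Γ_M → Γ_K`: primes, decomposition, inertia,
Frobenius (trunk GalRep)

For an extension `M/K` of fields the chosen embedding `ι : K̄ → M̄` (`Literature.NumberTheory.GaloisRepresentations.absClosureEmbedding`)
maps the absolute integers `\bar ℤ_K = absIntegers (𝓞 K) K` into `\bar ℤ_M`
(`ArtinRestriction.absClosureEmbedding_mem_absIntegers`); the induced ring homomorphism
`absIntegersMap K M : \bar ℤ_K →+* \bar ℤ_M` is injective, equivariant for the restriction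
`res = absGaloisRestrict K M : Γ_M → Γ_K` (`absIntegersMap_smul`), compatible with
`𝓞 K → 𝓞 M` (`absIntegersMap_comp_algebraMap`), and **bijective when `M/K` is algebraic**
(`absIntegersMap_surjective`, `absIntegersEquiv`).  Consequences, for a prime `𝔔` of `\bar ℤ_M`
and its contraction `𝔓 = ι⁻¹ 𝔔`:

* `comap_absIntegersMap_smul` — `ι⁻¹(γ 𝔔) = res(γ) ι⁻¹(𝔔)`;
* `comap_inertia_comap_absIntegersMap`, `comap_decompositionSubgroup_comap_absIntegersMap` —
  `res⁻¹(I_𝔓) = I_𝔔`, `res⁻¹(D_𝔓) = D_𝔔` (for `M/K` algebraic);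
* `forall_smul_sub_pow_mem_comap_iff` — `res γ` acts on `\bar ℤ_K / 𝔓` as `x ↦ x^n` iff `γ`
  acts on `\bar ℤ_M / 𝔔` as `x ↦ x^n`;
* `comap_absIntegersMap_mem_primesAbove`,
  `exists_heightOneSpectrum_of_comap_absIntegersMap_mem_primesAbove` — `𝔔 ∣ w ∣ v ⟹ 𝔓 ∣ v`,
  and conversely `𝔓 ∣ v ⟹ 𝔔 ∩ 𝓞 M` is a non-zero prime `w ∣ v` with `𝔔 ∣ w`;
* `smul_mem_primesAbove`, `under_smul_absIntegers` — `Γ_K` permutes the primes above `v`.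

This is the bookkeeping behind "the primes of `M` above `𝔭` correspond to the double cosets
`G_𝔓 \ G / H`" in the proof of the induction invariance of Artin L-functions (Neukirch,
*Algebraic Number Theory*, VII (10.4) (iv), p. 523; the bijection `H \ G / G_𝔓 → P_𝔭` is the
Remark after (9.2) in I §9).  The map `ι|_{\bar ℤ_K}` already
occurs, as a local definition, inside `Literature.NumberTheory.GaloisRepresentations.exists_primesAbove_restrict` (`ArtinRestriction`);
here it is named and its bijectivity is added.

## References

* J. Neukirch, *Algebraic Number Theory* (1999), Ch. I §9 ((9.1)–(9.6)), Ch. VII §10, proof of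
  (10.4) (iv), p. 523 (`NeukirchANT1999`).
* J. S. Milne, *Fields and Galois Theory*, §7 (restriction between absolute Galois groups)
  (`MilneFT2022`).
-/

noncomputable section

open scoped NumberField Pointwise
open Field IsDedekindDomain NumberField

namespace Literature.NumberTheory.GaloisRepresentations

section Map

variable (K M : Type*) [Field K] [Field M] [Algebra K M]

/-- The ring homomorphism `\bar ℤ_K → \bar ℤ_M` induced by the chosen embedding
`ι : K̄ → M̄` (`absClosureEmbedding K M`) on absolute integers.
Ref: Neukirch, *Algebraic Number Theory*, Ch. I §9; Milne, *Fields and Galois Theory*, §7.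
[folklore] -/
def absIntegersMap : absIntegers (𝓞 K) K →+* absIntegers (𝓞 M) M :=
  ((absClosureEmbedding K M).toRingHom.comp (absIntegers (𝓞 K) K).val.toRingHom).codRestrict
    (absIntegers (𝓞 M) M) fun x => absClosureEmbedding_mem_absIntegers K M x

/-- Unfolding lemma: `absIntegersMap` is `ι` on underlying elements. [folklore] -/
@[simp] theorem coe_absIntegersMap (x : absIntegers (𝓞 K) K) :
    ((absIntegersMap K M x : absIntegers (𝓞 M) M) : AlgebraicClosure M) =
      absClosureEmbedding K M x := rfl

/-- `absIntegersMap` is injective (`ι` is a field homomorphism). [folklore] -/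
theorem absIntegersMap_injective : Function.Injective (absIntegersMap K M) := fun x y h => by
  apply Subtype.ext
  apply (absClosureEmbedding K M).toRingHom.injective
  exact congrArg Subtype.val h

/-- **Equivariance**: `ι (res γ • x) = γ • ι x` for `γ ∈ Γ_M` (`absGaloisRestrict_apply_smul`).
Ref: Milne, *Fields and Galois Theory*, §7. [folklore] -/
theorem absIntegersMap_smul (γ : absoluteGaloisGroup M) (x : absIntegers (𝓞 K) K) :
    absIntegersMap K M (absGaloisRestrict K M γ • x) = γ • absIntegersMap K M x := by
  apply Subtype.ext
  rw [coe_absIntegersMap]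
  change absClosureEmbedding K M (absGaloisRestrict K M γ • (x : AlgebraicClosure K)) =
    γ • absClosureEmbedding K M x
  exact absGaloisRestrict_apply_smul K M γ x

/-- Compatibility with the structure maps: `ι ∘ (𝓞 K → \bar ℤ_K) = (𝓞 M → \bar ℤ_M) ∘ (𝓞 K → 𝓞 M)`.
[folklore] -/
theorem absIntegersMap_comp_algebraMap :
    (absIntegersMap K M).comp (algebraMap (𝓞 K) (absIntegers (𝓞 K) K)) =
      (algebraMap (𝓞 M) (absIntegers (𝓞 M) M)).comp (algebraMap (𝓞 K) (𝓞 M)) := by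
  ext r
  change absClosureEmbedding K M (algebraMap (𝓞 K) (AlgebraicClosure K) r) =
    algebraMap (𝓞 M) (AlgebraicClosure M) (algebraMap (𝓞 K) (𝓞 M) r)
  rw [IsScalarTower.algebraMap_apply (𝓞 K) K (AlgebraicClosure K), AlgHom.commutes,
    IsScalarTower.algebraMap_apply (𝓞 M) M (AlgebraicClosure M),
    ← IsScalarTower.algebraMap_apply (𝓞 K) (𝓞 M) M, IsScalarTower.algebraMap_apply (𝓞 K) K M,
    ← IsScalarTower.algebraMap_apply K M (AlgebraicClosure M)]

/-- Pointwise form of `absIntegersMap_comp_algebraMap`. [folklore] -/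
theorem absIntegersMap_algebraMap (r : 𝓞 K) :
    absIntegersMap K M (algebraMap (𝓞 K) (absIntegers (𝓞 K) K) r) =
      algebraMap (𝓞 M) (absIntegers (𝓞 M) M) (algebraMap (𝓞 K) (𝓞 M) r) :=
  RingHom.congr_fun (absIntegersMap_comp_algebraMap K M) r

/-- **For `M/K` algebraic, `\bar ℤ_K → \bar ℤ_M` is surjective** (`ι : K̄ → M̄` is then an
isomorphism, and integrality over `ℤ` is detected after an injective ring homomorphism).
Ref: Neukirch, *Algebraic Number Theory*, Ch. I §9. [folklore] -/
theorem absIntegersMap_surjective [Algebra.IsAlgebraic K M] :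
    Function.Surjective (absIntegersMap K M) := by
  intro y
  letI := absClosureAlgebra K M
  haveI := absClosure_isScalarTower K M
  haveI : Algebra.IsAlgebraic (AlgebraicClosure K) (AlgebraicClosure M) :=
    Algebra.IsAlgebraic.tower_top (K := K) (AlgebraicClosure K)
  have hbij : Function.Bijective (absClosureEmbedding K M) :=
    IsAlgClosed.algebraMap_bijective_of_isIntegral (k := AlgebraicClosure K)
      (K := AlgebraicClosure M)
  obtain ⟨x, hx⟩ := hbij.2 (y : AlgebraicClosure M)
  have hyint : IsIntegral ℤ (y : AlgebraicClosure M) :=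
    isIntegral_trans (R := ℤ) (A := 𝓞 M) _ y.2
  rw [← hx] at hyint
  have hxint : IsIntegral ℤ x :=
    (isIntegral_algHom_iff (absClosureEmbedding K M).toRingHom.toIntAlgHom hbij.1).mp hyint
  refine ⟨⟨x, (hxint.tower_top : IsIntegral (𝓞 K) x)⟩, Subtype.ext ?_⟩
  rw [coe_absIntegersMap]
  exact hx

/-- **`\bar ℤ_K ≅ \bar ℤ_M`** for `M/K` algebraic: the ring isomorphism induced by `ι`.
Ref: Neukirch, *Algebraic Number Theory*, Ch. I §9. [folklore] -/
def absIntegersEquiv [Algebra.IsAlgebraic K M] : absIntegers (𝓞 K) K ≃+* absIntegers (𝓞 M) M :=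
  RingEquiv.ofBijective (absIntegersMap K M)
    ⟨absIntegersMap_injective K M, absIntegersMap_surjective K M⟩

/-- Unfolding lemma for `absIntegersEquiv`. [folklore] -/
@[simp] theorem absIntegersEquiv_apply [Algebra.IsAlgebraic K M] (x : absIntegers (𝓞 K) K) :
    absIntegersEquiv K M x = absIntegersMap K M x := rfl

/-- The ring homomorphism underlying `absIntegersEquiv` is `absIntegersMap`. [folklore] -/
theorem coe_absIntegersEquiv [Algebra.IsAlgebraic K M] :
    (absIntegersEquiv K M : absIntegers (𝓞 K) K →+* absIntegers (𝓞 M) M) = absIntegersMap K M :=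
  RingHom.ext fun _ => rfl

end Map

/-! ### Ideals: conjugation, decomposition and inertia groups, Frobenius -/

section Ideals

variable (K M : Type*) [Field K] [Field M] [Algebra K M]

/-- **`ι⁻¹(γ 𝔔) = res(γ) · ι⁻¹(𝔔)`** for an ideal `𝔔` of `\bar ℤ_M` and `γ ∈ Γ_M`.
Ref: Neukirch, *Algebraic Number Theory*, Ch. I §9. [folklore] -/
theorem comap_absIntegersMap_smul (γ : absoluteGaloisGroup M) (𝔔 : Ideal (absIntegers (𝓞 M) M)) :
    (γ • 𝔔).comap (absIntegersMap K M) = absGaloisRestrict K M γ • 𝔔.comap (absIntegersMap K M) := by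
  ext x
  rw [Ideal.mem_comap, Ideal.mem_pointwise_smul_iff_inv_smul_mem,
    Ideal.mem_pointwise_smul_iff_inv_smul_mem, Ideal.mem_comap, ← map_inv, absIntegersMap_smul]

/-- `res(I_𝔔) ≤ I_{ι⁻¹ 𝔔}`: the restriction maps the inertia group of `𝔔` into that of its
contraction. Ref: Neukirch, *Algebraic Number Theory*, Ch. I §9. [folklore] -/
theorem absGaloisRestrict_mem_inertia_comap {𝔔 : Ideal (absIntegers (𝓞 M) M)}
    {γ : absoluteGaloisGroup M} (hγ : γ ∈ 𝔔.inertia (absoluteGaloisGroup M)) :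
    absGaloisRestrict K M γ ∈ (𝔔.comap (absIntegersMap K M)).inertia (absoluteGaloisGroup K) := by
  intro x
  change absGaloisRestrict K M γ • x - x ∈ Ideal.comap (absIntegersMap K M) 𝔔
  rw [Ideal.mem_comap, map_sub, absIntegersMap_smul]
  exact hγ _

/-- **`res⁻¹(I_{ι⁻¹ 𝔔}) = I_𝔔`** for `M/K` algebraic.
Ref: Neukirch, *Algebraic Number Theory*, Ch. I §9, (9.4)–(9.6). [folklore] -/
theorem comap_inertia_comap_absIntegersMap [Algebra.IsAlgebraic K M]
    (𝔔 : Ideal (absIntegers (𝓞 M) M)) :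
    ((𝔔.comap (absIntegersMap K M)).inertia (absoluteGaloisGroup K)).comap
        (absGaloisRestrict K M).toMonoidHom = 𝔔.inertia (absoluteGaloisGroup M) := by
  ext γ
  rw [Subgroup.mem_comap]
  refine ⟨fun h z => ?_, fun h => absGaloisRestrict_mem_inertia_comap K M h⟩
  obtain ⟨x, rfl⟩ := absIntegersMap_surjective K M z
  have hx := h x
  change absGaloisRestrict K M γ • x - x ∈ Ideal.comap (absIntegersMap K M) 𝔔 at hx
  rwa [Ideal.mem_comap, map_sub, absIntegersMap_smul] at hx

/-- **`res⁻¹(D_{ι⁻¹ 𝔔}) = D_𝔔`** for `M/K` algebraic.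
Ref: Neukirch, *Algebraic Number Theory*, Ch. I §9, (9.1)–(9.4). [folklore] -/
theorem comap_decompositionSubgroup_comap_absIntegersMap [Algebra.IsAlgebraic K M]
    (𝔔 : Ideal (absIntegers (𝓞 M) M)) :
    ((𝔔.comap (absIntegersMap K M)).decompositionSubgroup (absoluteGaloisGroup K)).comap
        (absGaloisRestrict K M).toMonoidHom = 𝔔.decompositionSubgroup (absoluteGaloisGroup M) := by
  ext γ
  rw [Subgroup.mem_comap, Ideal.mem_decompositionSubgroup_iff, Ideal.mem_decompositionSubgroup_iff]
  change absGaloisRestrict K M γ • Ideal.comap (absIntegersMap K M) 𝔔 = _ ↔ _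
  rw [← comap_absIntegersMap_smul]
  exact (Ideal.comap_injective_of_surjective _ (absIntegersMap_surjective K M)).eq_iff

/-- **Frobenius transport**: `res γ • x ≡ x^n (mod ι⁻¹ 𝔔)` for all `x ∈ \bar ℤ_K` iff
`γ • z ≡ z^n (mod 𝔔)` for all `z ∈ \bar ℤ_M` (`M/K` algebraic).
Ref: Neukirch, *Algebraic Number Theory*, Ch. I §9, (9.4)–(9.5). [folklore] -/
theorem forall_smul_sub_pow_mem_comap_iff [Algebra.IsAlgebraic K M]
    (𝔔 : Ideal (absIntegers (𝓞 M) M)) (γ : absoluteGaloisGroup M) (n : ℕ) :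
    (∀ x : absIntegers (𝓞 K) K,
        absGaloisRestrict K M γ • x - x ^ n ∈ 𝔔.comap (absIntegersMap K M)) ↔
      ∀ z : absIntegers (𝓞 M) M, γ • z - z ^ n ∈ 𝔔 := by
  constructor
  · intro h z
    obtain ⟨x, rfl⟩ := absIntegersMap_surjective K M z
    have hx := h x
    rwa [Ideal.mem_comap, map_sub, map_pow, absIntegersMap_smul] at hx
  · intro h x
    rw [Ideal.mem_comap, map_sub, map_pow, absIntegersMap_smul]
    exact h _

end Ideals

/-! ### Primes above a finite place (number fields) -/

section Primes

variable (K M : Type*) [Field K] [Field M] [Algebra K M]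

/-- The contraction of an ideal `𝔔` of `\bar ℤ_M` to `𝓞 K` through `\bar ℤ_K` is its contraction
through `𝓞 M`: `(ι⁻¹ 𝔔) ∩ 𝓞 K = (𝔔 ∩ 𝓞 M) ∩ 𝓞 K`. [folklore] -/
theorem under_comap_absIntegersMap (𝔔 : Ideal (absIntegers (𝓞 M) M)) :
    (𝔔.comap (absIntegersMap K M)).under (𝓞 K) =
      (𝔔.under (𝓞 M)).comap (algebraMap (𝓞 K) (𝓞 M)) := by
  change Ideal.comap (algebraMap (𝓞 K) (absIntegers (𝓞 K) K)) (Ideal.comap (absIntegersMap K M) 𝔔) =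
    Ideal.comap (algebraMap (𝓞 K) (𝓞 M)) (Ideal.comap (algebraMap (𝓞 M) (absIntegers (𝓞 M) M)) 𝔔)
  rw [Ideal.comap_comap, Ideal.comap_comap, absIntegersMap_comp_algebraMap]

variable {K M}

/-- **`𝔔 ∣ w ∣ v ⟹ ι⁻¹ 𝔔 ∣ v`**: the contraction to `\bar ℤ_K` of a prime of `\bar ℤ_M` above
a place `w` of `M` lies above the place `v` of `K` below `w`.
Ref: Neukirch, *Algebraic Number Theory*, Ch. I §9. [folklore] -/
theorem comap_absIntegersMap_mem_primesAbove {v : HeightOneSpectrum (𝓞 K)}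
    {w : HeightOneSpectrum (𝓞 M)} (hw : w.asIdeal.under (𝓞 K) = v.asIdeal)
    {𝔔 : Ideal (absIntegers (𝓞 M) M)} (h𝔔 : 𝔔 ∈ w.primesAbove) :
    𝔔.comap (absIntegersMap K M) ∈ v.primesAbove := by
  haveI := h𝔔.1
  refine ⟨Ideal.comap_isPrime _ 𝔔, ⟨?_⟩⟩
  rw [under_comap_absIntegersMap, ← h𝔔.2.over, ← hw]

/-- **`ι⁻¹ 𝔔 ∣ v ⟹ 𝔔 ∣ w` for the prime `w = 𝔔 ∩ 𝓞 M`, which lies above `v`.**  For a prime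
`𝔔` of `\bar ℤ_M` whose contraction to `\bar ℤ_K` lies above the finite place `v` of `K`, the
ideal `𝔔 ∩ 𝓞 M` is a non-zero prime of `𝓞 M` above `v` (and `𝔔` lies above it).
Ref: Neukirch, *Algebraic Number Theory*, Ch. I §9. [folklore] -/
theorem exists_heightOneSpectrum_of_comap_absIntegersMap_mem_primesAbove
    {v : HeightOneSpectrum (𝓞 K)} {𝔔 : Ideal (absIntegers (𝓞 M) M)} [𝔔.IsPrime]
    (h : 𝔔.comap (absIntegersMap K M) ∈ v.primesAbove) :
    ∃ w : HeightOneSpectrum (𝓞 M), w.asIdeal.under (𝓞 K) = v.asIdeal ∧ 𝔔 ∈ w.primesAbove ∧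
      w.asIdeal = 𝔔.under (𝓞 M) := by
  have hv : (𝔔.under (𝓞 M)).comap (algebraMap (𝓞 K) (𝓞 M)) = v.asIdeal := by
    rw [← under_comap_absIntegersMap, ← h.2.over]
  have hne : 𝔔.under (𝓞 M) ≠ ⊥ := by
    intro h0
    apply v.ne_bot
    rw [← hv, h0, Ideal.comap_bot_of_injective]
    exact FaithfulSMul.algebraMap_injective (𝓞 K) (𝓞 M)
  exact ⟨⟨𝔔.under (𝓞 M), Ideal.IsPrime.under (𝓞 M) 𝔔, hne⟩, hv, ⟨‹_›, ⟨rfl⟩⟩, rfl⟩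

end Primes

section Conjugates

variable {K : Type*} [Field K]

/-- Primes of `\bar ℤ_K` above `v` are permuted by `Γ_K`. [folklore] -/
theorem smul_mem_primesAbove {v : HeightOneSpectrum (𝓞 K)} {𝔓 : Ideal (absIntegers (𝓞 K) K)}
    (h𝔓 : 𝔓 ∈ v.primesAbove) (g : absoluteGaloisGroup K) : g • 𝔓 ∈ v.primesAbove := by
  haveI := h𝔓.1
  refine ⟨Ideal.IsPrime.smul g, ⟨?_⟩⟩
  rw [Ideal.under_smul, h𝔓.2.over]

/-- `Γ_K`-conjugate ideals of `\bar ℤ_K` contract to the same ideal of `𝓞 K` (Mathlib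
`Ideal.under_smul`, recorded for the non-reducible `Field.absoluteGaloisGroup`). [folklore] -/
theorem under_smul_absIntegers (g : absoluteGaloisGroup K) (𝔓 : Ideal (absIntegers (𝓞 K) K)) :
    (g • 𝔓).under (𝓞 K) = 𝔓.under (𝓞 K) :=
  Ideal.under_smul (𝓞 K) 𝔓 g

end Conjugates

end Literature.NumberTheory.GaloisRepresentations
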